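import Mathlib.AlgebraicGeometry.ProjectiveSpectrum.Topology
import Literature.AlgebraicGeometry.Motives.BettiRealization
import Literature.AlgebraicGeometry.Motives.Lefschetz
import HarnessLib

-- provenance: harness21/H21/H21/Statements/Hodge/Sweep1.lean @ cf87349 (interim HEAD d8f2665); M5 mechanical rewrite
/-!
# Hodge family, statement sweep 1

Family `hodge` (trunk MotiveAbstract). This file states the target statements of the
family that were not yet elaborated and are statable against Mathlib and the accepted H21
preludes with a small amount of local glue.

## Covered

* **hodge.S15** (Hodge–Riemann bilinear relations, Voisin I Thm. 6.32; Hodge index theorem for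
  surfaces, Hartshorne V.1.9), against a Betti–Hodge realization datum `B : Literature.BettiHodgeData k`.
  Note: the *harmonic-form* version of S15 on a compact Kähler manifold is already the theorem
  `hodge_riemann_bilinear` of `H21/Statements/Hodge/HodgeDecomposition.lean`; the three
  statements here (HR-I and HR-II for the Betti realization of a smooth projective variety with
  its Hodge filtration and Lefschetz form, and the Hodge index theorem for surfaces) are the
  complementary algebro-geometric forms, not duplicates.
* **hodge.S33** (the Hodge conjecture for smooth cubic fourfolds, Zucker 1977; for smooth quartic
  and quintic fourfolds, Conte–Murre 1978; for Fermat varieties of prime degree or degree `≤ 20`,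
  Shioda 1979 / Ran 1980), against `B : Literature.BettiHodgeData ℂ`. Local glue: smooth hypersurfaces
  of `ℙᴺ` cut out (set-theoretically, with reduced = smooth scheme structure) by a homogeneous
  form; Fermat varieties.

**Declaration form for S15/S33.** Following the policy of `H21/Statements/Hodge/BettiCycles.lean`
(`LefschetzOneOneStatement`, `HodgeDegreeTwoNMinusTwoStatement`): these are theorems for the
*classical* Betti realization, but nothing in the fields of an abstract `B : BettiHodgeData k`
pins `B.hodge` to the actual Hodge decomposition (nor `B.W`'s trace / cycle map to the classical
ones), so they are **not** consequences of the axioms of `B` and are stated as `Prop`-valued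
definitions `…Statement B`, never as `theorem`s. Each takes the datum `B` as an EXPLICIT binder
(`def …Statement (B : BettiHodgeData k) : Prop`): they are `B`-parametrised PREDICATES —
hypothesis schemata consumed as `(h : …Statement B)` — and not closed named facts awaiting a
discharge. Their universal closures `∀ B, …Statement B` are not what the sources prove (the
sources prove them for THE Hodge decomposition of `X`, i.e. for the classical datum, which the
tree does not construct), and two of these closures are refuted in the tree relative to
classical inputs: `HodgeRiemannIIStatement_not_forall_of_bettiOne`
(`Motives/Sweep1HodgeRiemannConjugate`: the conjugate re-decoration `B.conjugate` keeps every
field of `BettiHodgeData` and flips the sign of HR-II in odd degree) and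
`BettiHodgeData.not_forall_hodgeConjectureFor_of_hodgeNumber_ne_zero`
(`Motives/BettiRealizationPure`: the pure-even re-decoration `B.pureEven` turns every
`B.HodgeConjectureFor hX p`, hence the three S33 statements, into `ℚ · Aᵖ(X) = H²ᵖ(X)`). The
first relation `HodgeRiemannIStatement B` is invariant under both re-decorations
(`hodgeRiemannIStatement_conjugate_iff`; in even degree `2p` the pure `(p,p)` filtration makes
it vacuous) and no refutation of its closure is formalized, but its classical proof (Voisin I,
proof of Thm. 6.32: `Lⁿ⁻ᵏα ∧ β̄` has type `(n-k+p+q′, n-k+p′+q)` and `H²ⁿ(X)` is of type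
`(n, n)`) uses the compatibility of the Hodge decomposition with cup products and the Hodge type
of `H²ⁿ`, neither of which is a field of `BettiHodgeData`. Same treatment as the `B`-parametrised
renderings of `Literature/Barriers/HodgeConjecture/DecompositionOfTheDiagonal` (verdict clean-up
v4).

## Not covered here

* hodge.S07 (Hodge decomposition): already carried by `H21/Statements/Hodge/HodgeDecomposition.lean`
  (`isInternal_hodgePQ`, `conj_hodgePQ_eq`, Dolbeault and harmonic identifications) on top of
  `Literature.Prelude.TranscendKaehlerL.ComplexForms` / `.Dolbeault` / `.KaehlerHodge`; not restated.
* hodge.S27 (Faltings 1983 Sätze 3–4; Tate 1966): already carried by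
  `H21/Statements/Hodge/FaltingsAbelian.lean` (`faltings_tate_bijective`,
  `faltings_tate_end_bijective`, `isSemisimpleRepresentation_rationalTateRep`,
  `tate_bijective_of_finite`, …) on top of `Literature.Prelude.ArithGeomL.AVGaloisModule` /
  `.AVIsogenyTate` (genuine tensor-product map `faltingsTateMap`); not restated.
* hodge.S23 (Voisin's Kähler counterexample; Zucker's torus): missing notions are *coherent
  analytic sheaves on a compact complex manifold and their Chern classes `c₂(𝓕) ∈ H⁴(X, ℚ)`*
  (H21 Chern classes, `Literature.Prelude.MotiveL.ChernClasses`, are for algebraic bundles via a Weil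
  cohomology) and, for Zucker's appendix, the *cycle class of a closed analytic subset of a compact
  complex manifold* in Betti cohomology (`Literature.Prelude.Kaehler.AnalyticSet` has analytic sets but
  no fundamental class / no comparison of `hodgePQ` with rational singular classes on a
  non-algebraic torus).
* hodge.S28 (pure motives modulo an adequate equivalence; Jannsen's semisimplicity theorem):
  missing notions are *adequate equivalence relations on cycles* in general, the *intersection
  product / composition of correspondences modulo such a relation* (Chow ring), and the
  *pseudo-abelian envelope* construction of the category of motives; H21 has only the four named
  equivalences as subgroups (`ratTrivial`, `algTrivial`, `homTrivial`, `numTrivial`) without ring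
  structure, and correspondences only modulo homological equivalence.

## Design notes

* hodge.S15 is stated for the cohomology `B.W` of a `BettiHodgeData k` (`k ⊆ ℂ`), whose Hodge
  filtration lives on `ℂ ⊗_ℚ Hⁱ(X)`; the intersection form `Q(a, b) = tr(a ∪ ηʳ ∪ b)` is defined
  for any pre-Weil cohomology (`PreWeilCohomology.lefschetzForm`, a deliberate dot-notation
  extension of the H21 namespace `Literature.AlgebraicGeometry.Motives.PreWeilCohomology`, next to `primitivePart`), is
  base-changed with `LinearMap.baseChange` exactly as in `HodgeStructure.Polarization`, and
  primitivity is membership in `(B.W.primitivePart X η …).baseChange ℂ`. Degrees are cast-free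
  (`i + r = n`, `i + 2r = j`). The Hodge index theorem is kept in Hartshorne's literal form; its
  relation to the accepted `WeilCohomology.StandardConjectureHdg 2 X η` is explained at
  `HodgeIndexSurfaceStatement`.
* hodge.S33. Mathlib has `Proj` and `ProjectiveSpectrum.zeroLocus` but no graded quotient rings,
  so a hypersurface `V₊(F) ⊆ ℙᴺ` cannot be built as `Proj (k[x]/F)`. We define
  `IsHypersurfaceCutOutBy F X`: `X` is reduced and admits a closed `k`-immersion into `ℙᴺ_k` with
  image `ProjectiveSpectrum.zeroLocus _ {F}`. For `F` irreducible the closed subscheme `V₊(F)` is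
  integral, so a reduced closed subscheme with the same support *is* `V₊(F)`; smoothness of
  `V₊(F)` (which for `N ≥ 2` forces `F` irreducible) is then `IsSmoothProjective (N - 1) X`.
  **Flags:** the general Conte–Murre theorem (fourfolds covered by a `≥ 3`-dimensional family of
  rational curves) is NOT stated, only its named corollary for quartic and quintic fourfolds;
  Shioda's "and their products" (products of Fermat varieties, and Ran's refinements) is NOT
  stated, only the Fermat varieties `Xⁿₘ` themselves.

## References

* C. Voisin, *Hodge Theory and Complex Algebraic Geometry I*, §6.3.2, Thm. 6.32;
  R. Hartshorne, *Algebraic Geometry*, V.1.9.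
* S. Zucker, Compositio Math. 34 (1977), Thm. 3.2; A. Conte, J. Murre, Math. Ann. 238 (1978),
  Thms. 1–3; T. Shioda, Math. Ann. 245 (1979), Thms. III–IV; Z. Ran, Compositio Math. 42 (1980).
-/

noncomputable section

open CategoryTheory AlgebraicGeometry
open scoped TensorProduct

universe u v

namespace Literature.AlgebraicGeometry.Motives

/-! ## hodge.S15: Hodge–Riemann bilinear relations and the Hodge index theorem -/

namespace PreWeilCohomology

variable {k : Type u} [Field k] {K : Type v} [Field K] (W : PreWeilCohomology k K)
variable (X : SchemeOver k) {n : ℕ}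

/-- The Lefschetz intersection form `Q(a, b) = tr_X (a ∪ (b ∪ ηʳ))` on `Hⁱ(X)`, for
`i + 2r = j`, `i + j = 2n` (so `r = n - i`), for any pre-Weil cohomology theory (Kleiman 1968,
§3, before Thm. 3.11; Voisin I, (6.11) before Thm. 6.32: `H_ω(α, β) = ∫_X ω^{n-k} ∧ α ∧ β`, up to
the graded-commutativity sign absorbed by symmetry). Dot-notation extension of
`Literature.AlgebraicGeometry.Motives.PreWeilCohomology`, next to `primitivePart`. [cite: Kleiman1968, §3  before Thm. 3.11] -/
def lefschetzForm (η : W.obj X 2) (i r j : ℕ) (hj : i + 2 * r = j) (hn : i + j = 2 * n) :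
    LinearMap.BilinForm K (W.obj X i) :=
  (W.cupPairing X n i j hn).compl₂ (W.lefschetzPow X η r i j hj)

/-- Unfolding `lefschetzForm`. [folklore] -/
theorem lefschetzForm_apply (η : W.obj X 2) (i r j : ℕ) (hj : i + 2 * r = j)
    (hn : i + j = 2 * n) (a b : W.obj X i) :
    W.lefschetzForm X η i r j hj hn a b =
      W.trace X n (W.cup hn a (W.lefschetzPow X η r i j hj b)) :=
  rfl

end PreWeilCohomology

section Hodge

section HodgeRiemann

variable {k : Type} [Field k] [Algebra k ℂ]

/-- **hodge.S15** (first Hodge–Riemann bilinear relation; Voisin, *Hodge Theory I*,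
Thm. 6.32 (i) / Lemma 7.30). For every `X` smooth projective of dimension `n` over `k ⊆ ℂ`,
every hyperplane class `η` and `i + r = n`, the complexified Lefschetz form
`Q(a, b) = tr(a ∪ b ∪ ηʳ)` on `Hⁱ(X)` satisfies `Q_ℂ(Fᵖ, F^{i+1-p}) = 0` (equivalently
`Q_ℂ(H^{p,q}, H^{p',q'}) = 0` unless `(p', q') = (q, p)`). A theorem for the classical Betti
realization; not a consequence of the fields of an abstract `B : BettiHodgeData k` (nothing pins
`B.hodge` to the actual Hodge decomposition: the printed proof uses the compatibility of the
Hodge types with `∪` and the type `(n, n)` of `H²ⁿ(X)`, which are not fields of `B`), hence a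
`Prop`-valued PREDICATE of the explicit datum `B` — a hypothesis schema to be consumed as
`(h : HodgeRiemannIStatement B)`, not a named fact: its closure `∀ B, HodgeRiemannIStatement B`
is not what the source proves (module docstring, "Declaration form"; cf.
`hodgeRiemannIStatement_conjugate_iff` in `Motives/Sweep1HodgeRiemannConjugate`).
[cite: VoisinHodgeI2002, Thm. 6.32 (first assertion) and Lemma 7.30] -/
def HodgeRiemannIStatement (B : BettiHodgeData k) : Prop :=
  ∀ ⦃n : ℕ⦄ ⦃X : SchemeOver k⦄ (hX : IsSmoothProjective n X) ⦃η : B.W.obj X 2⦄,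
    B.W.IsHyperplaneClass X η → ∀ ⦃i r j : ℕ⦄ (hr : i + r = n) (hj : i + 2 * r = j) (p : ℤ)
      ⦃x y : ℂ ⊗[ℚ] B.W.obj X i⦄, x ∈ (B.hodge hX i).F p → y ∈ (B.hodge hX i).F (i + 1 - p) →
        (B.W.lefschetzForm X (n := n) η i r j hj (by omega)).baseChange ℂ x y = 0

/-- **hodge.S15** (second Hodge–Riemann bilinear relation = positivity on primitive
`(p, q)`-classes; Voisin, *Hodge Theory I*, Thm. 6.32 (ii)). For every `X` smooth projective of
dimension `n` over `k ⊆ ℂ`, every hyperplane class `η`, `i + r = n`, and every nonzero class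
`x ∈ H^{p,q}(X)` (`p + q = i`) which is *primitive*, i.e. lies in the complexification of
`Pⁱ(X) = ker (L^{r+1} : Hⁱ → H^{j+2})` (`W.primitivePart`), the number
`i^{p-q} (-1)^{i(i-1)/2} Q_ℂ(x, x̄)` is real and positive, where `Q(a, b) = tr(a ∪ b ∪ ηʳ)`.
Sign convention as in `HodgeStructure.Polarization`. A theorem for the classical Betti
realization; a `Prop`-valued PREDICATE of the explicit datum `B` (hypothesis schema, consumed as
`(h : HodgeRiemannIIStatement B)`), not a named fact: its closure `∀ B, HodgeRiemannIIStatement B`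
is refuted, relative to one datum and one smooth projective `X` with `b₁(X) ≠ 0`, by
`HodgeRiemannIIStatement_not_forall_of_bettiOne` (`Motives/Sweep1HodgeRiemannConjugate`).
[cite: VoisinHodgeI2002, Thm. 6.32 (second assertion)] -/
def HodgeRiemannIIStatement (B : BettiHodgeData k) : Prop :=
  ∀ ⦃n : ℕ⦄ ⦃X : SchemeOver k⦄ (hX : IsSmoothProjective n X) ⦃η : B.W.obj X 2⦄,
    B.W.IsHyperplaneClass X η → ∀ ⦃i r j : ℕ⦄ (hr : i + r = n) (hj : i + 2 * r = j) ⦃p q : ℤ⦄,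
      p + q = i → ∀ ⦃x : ℂ ⊗[ℚ] B.W.obj X i⦄, x ∈ (B.hodge hX i).piece p q → x ≠ 0 →
        x ∈ (B.W.primitivePart X η i (r + 1) (j + 2) (by omega)).baseChange ℂ →
          ∃ t : ℝ, 0 < t ∧
            Complex.I ^ p * (Complex.I ^ q)⁻¹ * (-1 : ℂ) ^ (i.choose 2) *
              (B.W.lefschetzForm X (n := n) η i r j hj (by omega)).baseChange ℂ x
                (HodgeStructure.conj x) = t

/-- **hodge.S15** (Hodge index theorem for surfaces; Hartshorne, *Algebraic Geometry*, V.1.9;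
signature `(1, ρ - 1)` on `NS(X) ⊗ ℚ`). For every smooth projective surface `X` with hyperplane
class `η` and every rational divisor class `D ∈ ℚ · A¹(X)` with `D · η = 0` which is not
numerically trivial, `D² < 0`; intersection numbers are the rational numbers `tr(D ∪ D')` of the
Betti realization `B.W`. **Relation to `WeilCohomology.StandardConjectureHdg 2 X η`** (the
accepted per-`(X, η)` standard conjecture of Hodge type): its `p = 1, r = 0` clause is the same
inequality under the hypotheses `D ≠ 0` (homologically) and `D ∪ η = 0 ∈ H⁴(X)`; since
"numerically nontrivial" implies `D ≠ 0`, the `Hdg` form is formally the stronger one (they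
agree because homological = numerical equivalence for divisors, Matsusaka 1957). We keep
Hartshorne's literal numerical form here. A theorem for the classical Betti realization; a
`Prop`-valued PREDICATE of the explicit datum `B` (only `B.W` is used: its trace and cycle-class
map are not pinned to the classical ones by the fields of `B`), a hypothesis schema consumed as
`(h : HodgeIndexSurfaceStatement B)`, not a named fact. [cite: Hartshorne1977, V.1.9] -/
def HodgeIndexSurfaceStatement (B : BettiHodgeData k) : Prop :=
  ∀ ⦃X : SchemeOver k⦄, IsSmoothProjective 2 X → ∀ ⦃η : B.W.obj X 2⦄,
    B.W.IsHyperplaneClass X η → ∀ ⦃D : B.W.obj X (2 * 1)⦄, D ∈ B.W.algebraicClasses X 1 →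
      B.W.cupPairing X 2 (2 * 1) (2 * 1) rfl D η = 0 →
        (∃ D' ∈ B.W.algebraicClasses X 1, B.W.cupPairing X 2 (2 * 1) (2 * 1) rfl D D' ≠ 0) →
          B.W.cupPairing X 2 (2 * 1) (2 * 1) rfl D D < 0

end HodgeRiemann

end Hodge

/-! ## hodge.S33: known cases of the Hodge conjecture (hypersurfaces, Fermat varieties) -/

section Hypersurfaces

variable {k : Type u} [Field k]

/-- `X` *is the (reduced) subscheme of `ℙᴺ_k` cut out set-theoretically by `F`*: `X` is reduced
and admits a closed `k`-immersion into `ℙᴺ_k = Proj k[x₀, …, x_N]` with image the zero locus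
`V₊(F) = ProjectiveSpectrum.zeroLocus _ {F}` (relevant homogeneous primes containing `F`). For
`F` homogeneous and irreducible the closed subscheme `Proj k[x]/(F)` is integral, hence equal to
the reduced induced structure on `V₊(F)`, so this predicate singles out exactly the hypersurface
`V₊(F)` up to `k`-isomorphism (Hartshorne II.5.9–5.10, II Ex. 3.11(d), II Ex. 5.14). Mathlib
has `Proj` but no graded quotient rings, whence this set-theoretic spelling. [folklore] -/
def IsHypersurfaceCutOutBy (N : ℕ) (F : MvPolynomial (Fin (N + 1)) k) (X : SchemeOver k) : Prop :=
  letI := MvPolynomial.gradedAlgebra (σ := Fin (N + 1)) (R := k)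
  IsReduced X.left ∧
    ∃ ι : X ⟶ projectiveSpace N k, IsClosedImmersion ι.left ∧
      Set.range ι.left.base =
        ProjectiveSpectrum.zeroLocus (MvPolynomial.homogeneousSubmodule (Fin (N + 1)) k) {F}

/-- `X` *is a smooth hypersurface of dimension `n` and degree `d`*: a smooth projective
geometrically integral `n`-fold over `k` which is the hypersurface `V₊(F) ⊆ ℙⁿ⁺¹_k` of an
irreducible homogeneous form `F` of degree `d` (Hartshorne I Ex. 5.9, II.8.20.3). (For `n ≥ 1` a
smooth hypersurface automatically has `F` irreducible, so no generality is lost.) [folklore] -/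
def IsSmoothHypersurface (n d : ℕ) (X : SchemeOver k) : Prop :=
  IsSmoothProjective n X ∧
    ∃ F : MvPolynomial (Fin (n + 2)) k, F.IsHomogeneous d ∧ Irreducible F ∧
      IsHypersurfaceCutOutBy (n + 1) F X

variable (k) in
/-- The Fermat form `x₀ᵐ + x₁ᵐ + ⋯ + x_{n+1}ᵐ` in `n + 2` variables (Shioda, Proc. Japan Acad.
55A (1979), eq. (1), p. 111; Math. Ann. 245 (1979), §1). [cite: Shioda1979PJA, eq. (1), p. 111] -/
def fermatPolynomial (n m : ℕ) : MvPolynomial (Fin (n + 2)) k :=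
  ∑ i : Fin (n + 2), MvPolynomial.X i ^ m

/-- The Fermat form is homogeneous of degree `m`. [folklore] -/
theorem isHomogeneous_fermatPolynomial (n m : ℕ) :
    (fermatPolynomial k n m).IsHomogeneous m := by
  refine MvPolynomial.IsHomogeneous.sum _ _ _ fun i _ ↦ ?_
  simpa using MvPolynomial.IsHomogeneous.pow (MvPolynomial.isHomogeneous_X k i) m

/-- `X` *is the Fermat variety `Xⁿₘ`*: the hypersurface `x₀ᵐ + ⋯ + x_{n+1}ᵐ = 0` in `ℙⁿ⁺¹_k`,
of dimension `n` and degree `m` (Shioda, Math. Ann. 245 (1979), §1). [folklore] -/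
def IsFermatVariety (n m : ℕ) (X : SchemeOver k) : Prop :=
  IsHypersurfaceCutOutBy (n + 1) (fermatPolynomial k n m) X

end Hypersurfaces

section Hodge

section KnownCases

/-- **hodge.S33** (Zucker, Compositio Math. 34 (1977), Thm. 3.2). The Hodge conjecture holds
(in every codimension `p`) for every smooth cubic fourfold `X ⊆ ℙ⁵_ℂ`. A theorem for the
classical Betti realization; not a consequence of the fields of an abstract
`B : BettiHodgeData ℂ`, hence a `Prop`-valued PREDICATE of the explicit datum `B` (hypothesis
schema, not a named fact: `BettiHodgeData.not_forall_hodgeConjectureFor_of_hodgeNumber_ne_zero`,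
`Motives/BettiRealizationPure`, refutes closures `∀ B, B.HodgeConjectureFor hX p` relative to one
non-zero off-diagonal Hodge number). [folklore] -/
def ZuckerCubicFourfoldStatement (B : BettiHodgeData ℂ) : Prop :=
  ∀ ⦃X : SchemeOver ℂ⦄ (h : IsSmoothHypersurface 4 3 X) (p : ℕ), B.HodgeConjectureFor h.1 p

/-- **hodge.S33** (Conte–Murre, Math. Ann. 238 (1978), Thms. 1–3 and their application). The
Hodge conjecture holds for every smooth quartic or quintic fourfold `X ⊆ ℙ⁵_ℂ`. **Flag:** only
this named corollary is stated; the general Conte–Murre theorem (the Hodge conjecture for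
fourfolds covered by a family of rational curves of dimension `≥ 3`) is NOT, for lack of the
"covering family of rational curves" vocabulary. A theorem for the classical Betti realization;
a `Prop`-valued PREDICATE of the explicit datum `B` (hypothesis schema, not a named fact; see
`ZuckerCubicFourfoldStatement`). [folklore] -/
def ConteMurreQuarticQuinticStatement (B : BettiHodgeData ℂ) : Prop :=
  ∀ ⦃X : SchemeOver ℂ⦄ ⦃d : ℕ⦄, d = 4 ∨ d = 5 → ∀ (h : IsSmoothHypersurface 4 d X) (p : ℕ),
    B.HodgeConjectureFor h.1 p

/-- **hodge.S33** (Shioda 1979; Ran 1980). The Hodge conjecture holds (in every codimension)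
for the Fermat variety `Xⁿₘ : x₀ᵐ + ⋯ + x_{n+1}ᵐ = 0` in `ℙⁿ⁺¹_ℂ`, of any dimension `n`, when the
degree `m` is prime or `m ≤ 20` (`m = 0` excluded: `IsSmoothProjective` rules out the empty
scheme anyway; `m = 1`, `Xⁿ₁ ≅ ℙⁿ`, is outside Shioda's standing assumption `m > 1` but there
the conjecture is trivial, all of `H^*(ℙⁿ, ℤ)` being algebraic).

**Sources.** Shioda, *The Hodge conjecture for Fermat varieties*, Math. Ann. 245 (1979),
175–184: the arithmetic criterion `(Pⁿₘ) ⇒ HC(Xⁿₘ)` (proved through the inductive structure of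
Fermat varieties) and its verification, announced in Shioda, Proc. Japan Acad. 55A (1979),
111–114, §2, Thm. 1 and the list following it (p. 112): `(Pⁿₘ)` is verified for `m` prime
(all `n`), for `m ≤ 20` (all `n`) and for `m = 21`, `n ≤ 10`, "therefore the Hodge Conjecture
for `Xⁿₘ` is true for these `m` and `n`"; the prime case is independently Ran, *Cycles on Fermat
hypersurfaces*, Compositio Math. 42 (1980), 121–142. For `m` prime or `m ≤ 20` the conjecture
then holds for arbitrary products `∏ X^{nᵢ}ₘ` in every codimension (Math. Ann. 245, Thm. IV, as
quoted in Shioda, *What is known about the Hodge Conjecture?*, Adv. Stud. Pure Math. 1 (1983),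
§2 (4b), p. 59); for a single smooth hypersurface only `n` even, `p = n / 2` is non-trivial
(loc. cit. §2 (4)).
**Flag:** the inventory's "and their products" (Shioda Thm. IV, Ran) is NOT stated, only the
Fermat varieties themselves; the extra verified case `m = 21, n ≤ 10` is NOT included.

**Status.** A theorem for the *classical* Betti realization only. Against an abstract
`B : BettiHodgeData ℂ` it is a `Prop`-valued PREDICATE of the explicit datum `B` (hypothesis
schema, not a named fact) and admits no closed proof `∀ B, ShiodaFermatStatement B`: the fields
of `BettiHodgeData` survive replacing `B.hodge` in every even degree `2k` by the pure
type-`(k, k)` structure (`HodgeStructure.pureOfEven`, bundled as the re-decoration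
`BettiHodgeData.pureEven` of `Motives/BettiRealizationPure`: pull-backs stay morphisms,
`HodgeStructure.Hom.pureOfEven`; polarizability is kept, `HodgeStructure.IsPolarizable.pureOfEven`;
cycle classes lie in `hodgeClasses = ⊤`, `BettiHodgeData.hodgeClasses_pureEven_two_mul`), after
which `HodgeConjectureFor hX p` reads `ℚ · Aᵖ(X) = H²ᵖ(X)`
(`BettiHodgeData.pureEven_hodgeConjectureFor_iff`), false for the Fermat quintic surface `X²₅`
(`p_g = 4`, `ρ = 37 < b₂ = 53`; in general
`BettiHodgeData.not_forall_hodgeConjectureFor_of_hodgeNumber_ne_zero`). Only the inclusion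
`Hdgᵖ ⊆ ℚ · Aᵖ` carries content (`shiodaFermatStatement_iff`). [cite: Shioda1979HodgeFermat, Thm. IV and the verification of (P_m) for m prime or m ≤ 20]
[cite: Shioda1979PJA, §2 Thm. 1 and the list after it (p. 112): the single Fermat variety] -/
def ShiodaFermatStatement (B : BettiHodgeData ℂ) : Prop :=
  ∀ ⦃n m : ℕ⦄ ⦃X : SchemeOver ℂ⦄ (hX : IsSmoothProjective n X), IsFermatVariety n m X →
    m.Prime ∨ (0 < m ∧ m ≤ 20) → ∀ p : ℕ, B.HodgeConjectureFor hX p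

/-- `ShiodaFermatStatement B` unfolds to the inclusions `Hdgᵖ(X) ⊆ ℚ · Aᵖ(X)` for the Fermat
varieties in range: the reverse inclusion is automatic for every Betti–Hodge datum
(`BettiHodgeData.algebraicClasses_le_hodgeClasses`, Voisin I, Prop. 11.20), so this is the form
in which Shioda's theorem is actually proved (Shioda1979PJA, §2, p. 112: "the space of rational
cohomology classes of type `(d, d)` on `X` is spanned over `ℚ` by the classes of algebraic
cycles of codimension `d`"). [folklore] -/
theorem shiodaFermatStatement_iff (B : BettiHodgeData ℂ) :
    ShiodaFermatStatement B ↔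
      ∀ ⦃n m : ℕ⦄ ⦃X : SchemeOver ℂ⦄ (hX : IsSmoothProjective n X), IsFermatVariety n m X →
        m.Prime ∨ (0 < m ∧ m ≤ 20) → ∀ p : ℕ,
          (B.hodge hX (2 * p)).hodgeClasses p ≤ B.W.algebraicClasses X p := by
  simp only [ShiodaFermatStatement, BettiHodgeData.hodgeConjectureFor_iff]

end KnownCases

end Hodge

end Literature.AlgebraicGeometry.Motives

end
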